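/-
Origin: expansion seat `planner-pub-hodgecm-mc-axioms-1-g14-0`, handover #W233 2026-08-20T15:53:55Z md5 b8b47bff9604 (PKG a49a75d97381 → b8b47bff9604; 283 l.; MECHANICAL (iib-R) rewrite v3.1 of the PKG file as it stands (88 token edits; rules R1x2+R2x2+RX[h₂]x84)) (`HOME/mc/pub-hodgecm-mc-axioms-1-g14/revendor/kit-r55/stage55/HodgeCM/Model/Binders/Real34MeetProj.lean`, md5 b8b47bff9604, 283 lines);
landed by the gen-22 packager (p-g22) in gate run 55 REPLACES the earlier landed copy of `HodgeCM/Model/Binders/Real34MeetProj.lean` (seat copy carried the packager Origin header of an earlier run (stripped)).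
-/
/-
COURTESY (W1) TWIN — cut by DISCHARGE seat `prover-pub-hodgecm-mc-discharge-1-g16-0` (unit pub-hodgecm-mc-discharge-1-g16), 2026-08-19T16:4xZ, for the
binder-1 lineage (row owner; adopt verbatim or re-cut — NOT filed in any kit by the discharge-1 seat): the RUN-37 (W1) twin of binder-1-g7's RUN-36 kit
row #13 `HodgeCM/Model/Binders/Real34MeetProj.lean` 49649909497d, which imports D-1′'s `Gen12ProjDischarge` (RUN-37 twin ⁗) and carries the same three
`levelOf` tokens (pv08-g33 16:23:21Z census): `set Kf := levelOf (Level.isCongruenceSubgroup_coe Γ)` ↦ `set Kf := Γ.K`, `isOpen_levelOf (…)` ↦ `Γ.isOpen_K`,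
`(arithmeticLevel_levelOf _).le` ↦ `Γ.arithmeticLevel_K.le`; every other byte = 49649909497d. Certified in the discharge-1 (W1) mirror on top of ⁗ (log next to it).
-/
/-
Origin: speedrun cell pub-hodgecm, MODEL-CONSTRUCTION sub-cell, unit pub-hodgecm-mc-binder-1-g7 (BINDER PROVER, gen 7; node
B2-meet, BINDER-OWNERS row 15 `real34`, the projection half of the `meet` clause of `Real34FunBridge`), seat
prover-pub-hodgecm-mc-binder-1-g7-0, 2026-08-19.  ADAPTED from mc-discharge-1's `Model/Binders/Gen12ProjDischarge.lean` af846a50bf0f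
(D-1′, `Gen12Junctions.proj_of_pieceUnfolding`): the SAME piece-unfolding argument with two DIFFERENT principal-piece functions on the
two sides of the inner product.  Target in PKG: HodgeCM/Model/Binders/Real34MeetProj.lean (NEW additive leaf; imports D-1′'s
`Model/Binders/Gen12ProjDischarge` only — hence the ‴ (J-x₀-emb) world of glue-1 #340; nothing landed imports it).
KERNEL ONLY: 0 records, nothing cited, 0 `def … : Prop`, MODEL-N ±0; one junction hypothesis `hι` as in D-1′.
-/
import Summits.HodgeConjecture.HodgeCM.Model.Binders.Gen12ProjDischarge

/-!
# The projection half of `meet` (row `real34`): `⟪Λ_Γ(η₁, η₂), realise (G₁ ∧ G₂)⟫ = ⟪Λ_Γ(η₁, η₂), Λ_Γ(cl₁, cl₂)⟫`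

`Real34FunBridge.meet` (PKG `Model/Binders/MeetBridges`; E binder `real34` via `Real34FunBridge.ofQautCore`) asks: a (12)-wedge
`Λ_{Γ₁}(ω₁, ω₂)` of `U_Ψ`-classes pairing non-trivially with a global (34)-wedge-function `P = realise (G₁ ∧ G₂)` pairs non-trivially, at
some level, with a (34)-wedge of `U_Ψ`-CLASSES.  At ONE level `Γ` (the cross-level bookkeeping — `Level.exists_le_le`, `pullC`,
`Fact_embCover`, theta-class pull-back — is separate) this is the identity proved here:

* **`inner_Λ_realise_wedge₂_of_pieceUnfolding (hι)`** — for ANY degree-one classes `η₁, η₂` at level `Γ` and any `(1,0)`-classes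
  `cl₁, cl₂` with SATURATED adelic representatives `G₁, G₂` (`SatLevel V hV Γ Gᵢ`, `pull clᵢ = Gᵢ ∘ ιinf` — exactly the data (J-rep)
  delivers for theta one-forms, binder-1 `Gen12RepOfSat`), `⟪Λ_Γ(η₁, η₂), realise (G₁ ∧ G₂)⟫ = ⟪Λ_Γ(η₁, η₂), Λ_Γ(cl₁, cl₂)⟫`
  (D-1′'s `proj_of_pieceUnfolding` is the case `η = cl`);
* **`inner_Λ_ne_zero_of_inner_realise_ne_zero`** — hence `⟪Λ_Γ(η₁, η₂), realise (G₁ ∧ G₂)⟫ ≠ 0 ⇒ ⟪Λ_Γ(cl₁, cl₂), Λ_Γ(η₁, η₂)⟫ ≠ 0`,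
  the conclusion shape of `meet` at level `Γ`.

Proof = D-1′'s three steps with the principal-piece function of `η₁ ∪ η₂` (`fL`) on the LEFT and that of `cl₁ ∪ cl₂` (`f`) on the RIGHT:
`Λ_Γ(·,·) = pieceEmb (principal lift of the top form)` (`embOf_apply`), the realised wedge agrees a.e. on the principal piece with
`pieceLift f` (tree `wedge_apply_inv_eq_pieceLift` + `formPullback₂_topFormOfClass_cup`, fed by `SatLevel`, `pull = G ∘ ιinf`, `hι`),
then `inner_pieceEmb_left … fL` and `inner_pieceEmb … fL f`.  Nothing here is a claim of the manuscripts under adjudication.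
-/

set_option autoImplicit false

noncomputable section

open scoped InnerProductSpace Matrix
open MeasureTheory MulAction Literature.MeasureTheory.Group
open Literature.NumberTheory.Automorphic Literature.NumberTheory.Automorphic.UnitaryGroup
open Literature.NumberTheory.Automorphic.LevelOrbit
open Literature.Geometry.ComplexHyperbolic.BallModel (U21 Ball x₀ Jac)
open Literature.AlgebraicGeometry.ShimuraVarieties
open NumberField

namespace HodgeCM

namespace Model

open Literature.AlgebraicGeometry.HodgeTheory
open Literature.NumberTheory.Automorphic.PicardCM
open Literature.NumberTheory.Transcendental (Arapura2012_Cor_15_4_6)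

variable (hHD : exists_isReal_hodgeModel) (hI : hodgePQ_independent_of_hodgeModel)
  (h₁ : BallQuotientUniformised)  (h₃ : CMAbelianVarietyRealised)
variable (h : Bool) (hA : Arapura2012_Cor_15_4_6)
  (W : ∀ {L : CMField} {ι₁ : L →+* ℂ} (V : HermSpace3 L ι₁) (c : SeesawCtx L), WmInput V c.D)
  (S : ∀ {L : CMField} {ι₁ : L →+* ℂ} (V : HermSpace3 L ι₁) (c : SeesawCtx L), ThetaAdelicSide V c)
  (μ : ∀ {L : CMField}, SeesawCtx L → Fin 4 → InfinitePlace L → ℤ)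

variable {L : CMField} {ι₁ : L →+* ℂ} (V : HermSpace3 L ι₁) (c : SeesawCtx L) (hV : IsAnisotropic L V.Hm)

variable (hHD : exists_isReal_hodgeModel) (hI : hodgePQ_independent_of_hodgeModel)
  (h₁ : BallQuotientUniformised)  (h₃ : CMAbelianVarietyRealised)
variable (h : Bool) (hA : Arapura2012_Cor_15_4_6)
  (W : ∀ {L : CMField} {ι₁ : L →+* ℂ} (V : HermSpace3 L ι₁) (c : SeesawCtx L), WmInput V c.D)
  (S : ∀ {L : CMField} {ι₁ : L →+* ℂ} (V : HermSpace3 L ι₁) (c : SeesawCtx L), ThetaAdelicSide V c)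
  (μ : ∀ {L : CMField}, SeesawCtx L → Fin 4 → InfinitePlace L → ℤ)

variable {L : CMField} {ι₁ : L →+* ℂ} (V : HermSpace3 L ι₁) (c : SeesawCtx L) (hV : IsAnisotropic L V.Hm)

set_option maxHeartbeats 1600000 in
/-- **The projection half of `meet`.**  For arbitrary degree-one classes `η₁, η₂` and `(1,0)`-classes `cl₁, cl₂` at level `Γ` with
saturated adelic representatives `G₁, G₂` pulling back to `pull cl₁, pull cl₂` along `ιinf`:
`⟪Λ_Γ(η₁, η₂), realise (G₁ ∧ G₂)⟫ = ⟪Λ_Γ(η₁, η₂), Λ_Γ(cl₁, cl₂)⟫` — the global (34)-wedge-function and the embedded class wedge have the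
same pairing with every embedded (12)-wedge.  Junction hypothesis `hι` as in D-1′ (`rfl` at the honest `S`). -/
theorem inner_Λ_realise_wedge₂_of_pieceUnfolding
    (hι : ∀ u : U21, (S V c).ιinf u =
      Adelic.regimeEquiv L V.Hm hV (archSectionU21CM (L : Type) ι₁ V.Hm V.sylvesterFrame (sylvesterFrame_J V) u)) :
    ∀ (Γ : Level V) (η₁ η₂ : (picardCMUniverse hHD hI h₁ h₃).CohC ((picardCMUniverse hHD hI h₁ h₃).pms L ι₁ V Γ) 1)
      (cl₁ cl₂ : ((pinX hHD hI h₁ h₃ S V c hV).D Γ).H10) (G₁ G₂ : (quotU V).leftInvCont₂),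
      SatLevel V hV Γ G₁ → SatLevel V hV Γ G₂ →
      ((((pinX hHD hI h₁ h₃ S V c hV).D Γ).pull cl₁).1 : (pinX hHD hI h₁ h₃ S V c hV).G₁ → (Fin 2 → ℂ)) =
        (G₁ : (quotU V).G → (Fin 2 → ℂ)) ∘ ((pinX hHD hI h₁ h₃ S V c hV).ιinf Γ) →
      ((((pinX hHD hI h₁ h₃ S V c hV).D Γ).pull cl₂).1 : (pinX hHD hI h₁ h₃ S V c hV).G₁ → (Fin 2 → ℂ)) =
        (G₂ : (quotU V).G → (Fin 2 → ℂ)) ∘ ((pinX hHD hI h₁ h₃ S V c hV).ιinf Γ) →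
      ⟪(pinT hHD hI h₁ h₃ h hA W S μ).Λ Γ η₁ η₂, (quotU V).realise ((quotU V).wedge₂ G₁ G₂)⟫_ℂ =
        ⟪(pinT hHD hI h₁ h₃ h hA W S μ).Λ Γ η₁ η₂,
          (pinT hHD hI h₁ h₃ h hA W S μ).Λ Γ
            (cl₁ : (picardCMUniverse hHD hI h₁ h₃).CohC ((picardCMUniverse hHD hI h₁ h₃).pms L ι₁ V Γ) 1)
            (cl₂ : (picardCMUniverse hHD hI h₁ h₃).CohC ((picardCMUniverse hHD hI h₁ h₃).pms L ι₁ V Γ) 1)⟫_ℂ := by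
  intro Γ η₁ η₂ cl₁ cl₂ G₁ G₂ hS₁ hS₂ hp₁ hp₂
  /- ### the data of the principal piece at level `Γ` (emb's own terms, tree spelling) -/
  set Kf := Γ.K with hKf
  have hKo := Γ.isOpen_K
  set M : Subgroup ↥(Literature.NumberTheory.Automorphic.adelicUnitaryGroup (L : Type) V.Hm) :=
    cmSplitLevel (L : Type) 3 V.Hm Kf with hM
  set π := cmSplitProj (L : Type) 3 V.Hm Kf with hπ
  have hMo : IsOpen (M : Set ↥(Literature.NumberTheory.Automorphic.adelicUnitaryGroup (L : Type) V.Hm)) :=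
    isOpen_cmSplitLevel (L : Type) 3 V.Hm Kf hKo
  have hπc : Continuous π := continuous_cmSplitProj (L : Type) 3 V.Hm Kf
  have hπs : Function.Surjective π := splitProj_surjective _ _
  haveI hcpt : CompactSpace (arch (↥(maximalRealSubfield L)) L (IsCMField.complexConj L) 3 V.Hm ⧸
      pieceLattice M (adelicUnitaryRat (L : Type) V.Hm) π (cmPrincipalPoint (L : Type) 3 V.Hm)) :=
    compactSpace_arch_quotient_cmPrincipalLattice_of_anisotropic (L : Type) 3 V.Hm Kf (hanis_of_isAnisotropic hV) hKo
  -- the regime transport to the quotient model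
  set e : ↥(Literature.NumberTheory.Automorphic.adelicUnitaryGroup (L : Type) V.Hm) ≃ₜ* (quotU V).G :=
    Adelic.regimeEquiv L V.Hm hV with he
  have hΓe : ∀ g, e g ∈ (quotU V).Γ ↔ g ∈ adelicUnitaryRat (L : Type) V.Hm :=
    V.regimeEquiv_mem_latticeModel_Γ_iff printFact_unitaryCompact_holds hV
  -- emb's datum, Hodge model, frame, realising data
  set D := embDatum h₁ h₃ Γ hV with hD
  set A := embHodgeModel hHD h₁ h₃ Γ with hAdef
  set 𝔣 := embFrameOf h₁ h₃ Γ hV with h𝔣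
  have hH : V.Hm.map ι₁ = D.H.map D.E.subtype :=
    map_Hm_eq_ballDatum_H_map (ballQuotientUniformisedDatum_of h₁) h₃ Γ ((isAnisotropic_pmsCode_iff L ι₁ V Γ).2 hV)
  have hK : arithmeticLevel (↥(maximalRealSubfield L)) L (IsCMField.complexConj L) 3 V.Hm Kf ≤ Γ.Γ :=
    Γ.arithmeticLevel_K.le
  have hΓ₀ := map_Γ_le_ballDatum (ballQuotientUniformisedDatum_of h₁) h₃ Γ ((isAnisotropic_pmsCode_iff L ι₁ V Γ).2 hV)
  -- the cup product, its holomorphic top form, its principal-piece function, and the piece lift of the latter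
  set η : (picardCMUniverse hHD hI h₁ h₃).CohC ((picardCMUniverse hHD hI h₁ h₃).pms L ι₁ V Γ) 2 :=
    (picardCMUniverse hHD hI h₁ h₃).cup2C ((picardCMUniverse hHD hI h₁ h₃).pms L ι₁ V Γ) 1
      (cl₁ : (picardCMUniverse hHD hI h₁ h₃).CohC ((picardCMUniverse hHD hI h₁ h₃).pms L ι₁ V Γ) 1)
      (cl₂ : (picardCMUniverse hHD hI h₁ h₃).CohC ((picardCMUniverse hHD hI h₁ h₃).pms L ι₁ V Γ) 1) with hη
  set α := embTopForm hHD hI h₁ h₃ Γ η with hα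
  set f := D.principalHolFormLiftCM A 𝔣 L V.Hm ι₁ hH Kf hK hΓ₀ α with hf
  -- the (12)-side: the cup of the two arbitrary classes `η₁, η₂`, its top form and principal-piece function
  set ηL : (picardCMUniverse hHD hI h₁ h₃).CohC ((picardCMUniverse hHD hI h₁ h₃).pms L ι₁ V Γ) 2 :=
    (picardCMUniverse hHD hI h₁ h₃).cup2C ((picardCMUniverse hHD hI h₁ h₃).pms L ι₁ V Γ) 1 η₁ η₂ with hηL
  set αL := embTopForm hHD hI h₁ h₃ Γ ηL with hαL
  set fL := D.principalHolFormLiftCM A 𝔣 L V.Hm ι₁ hH Kf hK hΓ₀ αL with hfL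
  /- ### Step 1′: `Λ_Γ(η₁, η₂)` is the piece embedding of `fL` -/
  have hΛL : (pinT hHD hI h₁ h₃ h hA W S μ).Λ Γ η₁ η₂ =
      (quotU V).pieceEmb (adelicUnitaryRat (L : Type) V.Hm) e hΓe M π (cmPrincipalPoint (L : Type) 3 V.Hm) hMo hπc fL := by
    rw [Universe.ThetaModel.Λ_apply]
    change embOf hHD hI h₁ h₃ Γ ηL = _
    rw [embOf_apply hHD hI h₁ h₃ Γ hV]
    rfl
  /- ### Step 1: `Λ_Γ(cl₁, cl₂)` is the piece embedding of `f` -/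
  have hΛ : (pinT hHD hI h₁ h₃ h hA W S μ).Λ Γ
      (cl₁ : (picardCMUniverse hHD hI h₁ h₃).CohC ((picardCMUniverse hHD hI h₁ h₃).pms L ι₁ V Γ) 1)
      (cl₂ : (picardCMUniverse hHD hI h₁ h₃).CohC ((picardCMUniverse hHD hI h₁ h₃).pms L ι₁ V Γ) 1) =
      (quotU V).pieceEmb (adelicUnitaryRat (L : Type) V.Hm) e hΓe M π (cmPrincipalPoint (L : Type) 3 V.Hm) hMo hπc f := by
    rw [Universe.ThetaModel.Λ_apply]
    change embOf hHD hI h₁ h₃ Γ η = _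
    rw [embOf_apply hHD hI h₁ h₃ Γ hV]
    rfl
  /- ### Step 2: the realised wedge agrees with the piece lift of `f` on the principal piece -/
  -- tree-side representatives
  have hsat : ∀ (G : (quotU V).leftInvCont₂), SatLevel V hV Γ G →
      ∀ g : ↥(Literature.NumberTheory.Automorphic.adelicUnitaryGroup (L : Type) V.Hm),
        ∀ k ∈ awayFromCM 3 (L : Type) ι₁ V.Hm ⊓ cmSplitLevel (L : Type) 3 V.Hm Kf,
          (fun x => (G : (quotU V).G → (Fin 2 → ℂ)) (e x)) (g * k) =
            (fun x => (G : (quotU V).G → (Fin 2 → ℂ)) (e x)) g := by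
    intro G hG g k hk
    exact (congrArg (fun t => (G : (quotU V).G → (Fin 2 → ℂ)) t) (map_mul e g k)).trans
      (hG (e g) (e k) (Subgroup.mem_map_of_mem (Adelic.regimeEquiv L V.Hm hV).toMonoidHom hk))
  have hpull : ∀ (cl : ((pinX hHD hI h₁ h₃ S V c hV).D Γ).H10) (G : (quotU V).leftInvCont₂),
      ((((pinX hHD hI h₁ h₃ S V c hV).D Γ).pull cl).1 : U21 → (Fin 2 → ℂ)) =
        (G : (quotU V).G → (Fin 2 → ℂ)) ∘ ((pinX hHD hI h₁ h₃ S V c hV).ιinf Γ) →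
      ∀ u : U21, (fun x => (G : (quotU V).G → (Fin 2 → ℂ)) (e x))
          (archSectionU21CM (L : Type) ι₁ V.Hm 𝔣.T (𝔣.conjTranspose_mul_map_mul V.Hm ι₁ hH) u) =
        (Jac u x₀)ᵀ *ᵥ D.classLift hHD 𝔣
          (cl : (picardCMUniverse hHD hI h₁ h₃).CohC ((picardCMUniverse hHD hI h₁ h₃).pms L ι₁ V Γ) 1) (u • x₀) := by
    intro cl G hp u
    have hc : (G : (quotU V).G → (Fin 2 → ℂ)) ((S V c).ιinf u) =
        ((((pinX hHD hI h₁ h₃ S V c hV).D Γ).pull cl).1 : U21 → (Fin 2 → ℂ)) u := by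
      rw [hp]; rfl
    have hι' : (S V c).ιinf u = e (archSectionU21CM (L : Type) ι₁ V.Hm 𝔣.T (𝔣.conjTranspose_mul_map_mul V.Hm ι₁ hH) u) :=
      hι u
    change (G : (quotU V).G → (Fin 2 → ℂ))
        (e (archSectionU21CM (L : Type) ι₁ V.Hm 𝔣.T (𝔣.conjTranspose_mul_map_mul V.Hm ι₁ hH) u)) = _
    rw [← hι', hc]
    exact classMapDatumOf_pull_apply hHD hI h₁ h₃ Γ hV (frameOf hHD hI h₁ h₃ Γ hV) (MonoidHom.id U21) _ _ cl u
  have hc₁ : (cl₁ : (picardCMUniverse hHD hI h₁ h₃).CohC ((picardCMUniverse hHD hI h₁ h₃).pms L ι₁ V Γ) 1) ∈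
      (BettiUniverse.hodge hHD (isSmoothProjective_pms h₁ h₃ Γ) 1).F 1 := cl₁.2
  have hc₂ : (cl₂ : (picardCMUniverse hHD hI h₁ h₃).CohC ((picardCMUniverse hHD hI h₁ h₃).pms L ι₁ V Γ) 1) ∈
      (BettiUniverse.hodge hHD (isSmoothProjective_pms h₁ h₃ Γ) 1).F 1 := cl₂.2
  have hwedge : ∀ z : Ball, D.formPullback₂ A 𝔣 α.1 z =
      D.classLift hHD 𝔣
          (cl₁ : (picardCMUniverse hHD hI h₁ h₃).CohC ((picardCMUniverse hHD hI h₁ h₃).pms L ι₁ V Γ) 1) z 0 *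
        D.classLift hHD 𝔣
          (cl₂ : (picardCMUniverse hHD hI h₁ h₃).CohC ((picardCMUniverse hHD hI h₁ h₃).pms L ι₁ V Γ) 1) z 1 -
      D.classLift hHD 𝔣
          (cl₁ : (picardCMUniverse hHD hI h₁ h₃).CohC ((picardCMUniverse hHD hI h₁ h₃).pms L ι₁ V Γ) 1) z 1 *
        D.classLift hHD 𝔣
          (cl₂ : (picardCMUniverse hHD hI h₁ h₃).CohC ((picardCMUniverse hHD hI h₁ h₃).pms L ι₁ V Γ) 1) z 0 :=
    fun z => D.formPullback₂_topFormOfClass_cup hHD 𝔣 hI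
      ((embHodgeModel hHD h₁ h₃ Γ).topHolFormClassPQ_bijective (isSmoothProjective_pms h₁ h₃ Γ)) hc₁ hc₂ z
  -- the pointwise identity on the piece (tree junction lemma #B1)
  have hpt := D.wedge_apply_inv_eq_pieceLift A 𝔣 L V.Hm ι₁ hH Kf hK hΓ₀
    (fun x => (G₁ : (quotU V).G → (Fin 2 → ℂ)) (e x)) (fun x => (G₂ : (quotU V).G → (Fin 2 → ℂ)) (e x)) _ _ α
    (hsat G₁ hS₁) (hsat G₂ hS₂) (hpull cl₁ G₁ hp₁) (hpull cl₂ G₂ hp₂) hwedge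
  -- a.e. agreement of the realised wedge with the piece lift of `f` on the piece
  have hvu : ∀ᵐ y ∂((quotU V).pullbackν (adelicUnitaryRat (L : Type) V.Hm) e hΓe),
      y ∈ MulAction.orbit M (cmPrincipalPoint (L : Type) 3 V.Hm) →
      (((quotU V).realise ((quotU V).wedge₂ G₁ G₂) : (quotU V).H) : (quotU V).G ⧸ (quotU V).Γ → ℂ)
          (cosetCongr e.toMulEquiv (adelicUnitaryRat (L : Type) V.Hm) (quotU V).Γ hΓe y) =
        pieceLift M (adelicUnitaryRat (L : Type) V.Hm) π (cmPrincipalPoint (L : Type) 3 V.Hm) f y := by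
    have hae := ((quotU V).measurePreserving_cosetCongr_pullbackν (adelicUnitaryRat (L : Type) V.Hm) e
      hΓe).quasiMeasurePreserving.ae_eq_comp
        (ContinuousMap.coeFn_toLp (E := ℂ) (p := 2) (μ := (quotU V).ν) (𝕜 := ℂ)
          ((quotU V).descendInv ((quotU V).wedge₂ G₁ G₂)))
    filter_upwards [hae] with y hy hmem
    rw [QuotientModel.realise_apply]
    refine hy.trans ?_
    obtain ⟨m, rfl⟩ := MulAction.mem_orbit_iff.1 hmem
    refine Eq.trans ?_ (hpt m)
    have hmx : ((m • cmPrincipalPoint (L : Type) 3 V.Hm :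
        ↥(Literature.NumberTheory.Automorphic.adelicUnitaryGroup (L : Type) V.Hm) ⧸ adelicUnitaryRat (L : Type) V.Hm)) =
        QuotientGroup.mk (m : ↥(Literature.NumberTheory.Automorphic.adelicUnitaryGroup (L : Type) V.Hm)) := by
      change QuotientGroup.mk ((m : ↥(Literature.NumberTheory.Automorphic.adelicUnitaryGroup (L : Type) V.Hm)) * 1) = _
      rw [mul_one]
    change (quotU V).descendInv ((quotU V).wedge₂ G₁ G₂)
        (cosetCongr e.toMulEquiv (adelicUnitaryRat (L : Type) V.Hm) (quotU V).Γ hΓe (m • cmPrincipalPoint (L : Type) 3 V.Hm)) = _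
    rw [hmx, cosetCongr_mk, QuotientModel.descendInv_mk, QuotientModel.coe_wedge₂, QuotientModel.wedge₂Fun_apply]
    change _ = (G₁ : (quotU V).G → (Fin 2 → ℂ)) (e (m : ↥(Literature.NumberTheory.Automorphic.adelicUnitaryGroup (L : Type) V.Hm))⁻¹) 0 *
        (G₂ : (quotU V).G → (Fin 2 → ℂ)) (e (m : ↥(Literature.NumberTheory.Automorphic.adelicUnitaryGroup (L : Type) V.Hm))⁻¹) 1 -
      (G₁ : (quotU V).G → (Fin 2 → ℂ)) (e (m : ↥(Literature.NumberTheory.Automorphic.adelicUnitaryGroup (L : Type) V.Hm))⁻¹) 1 *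
        (G₂ : (quotU V).G → (Fin 2 → ℂ)) (e (m : ↥(Literature.NumberTheory.Automorphic.adelicUnitaryGroup (L : Type) V.Hm))⁻¹) 0
    rw [map_inv]
    rfl
  have hu_inv : ∀ n : M, π n = 1 → ∀ y,
      pieceLift M (adelicUnitaryRat (L : Type) V.Hm) π (cmPrincipalPoint (L : Type) 3 V.Hm) f (n • y) =
        pieceLift M (adelicUnitaryRat (L : Type) V.Hm) π (cmPrincipalPoint (L : Type) 3 V.Hm) f y := fun n hn y =>
    pieceLift_smul_of_map_eq_one M (adelicUnitaryRat (L : Type) V.Hm) π (cmPrincipalPoint (L : Type) 3 V.Hm) f n hn y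
  have hum : AEStronglyMeasurable
      (pieceDescend M (adelicUnitaryRat (L : Type) V.Hm) π hπs (cmPrincipalPoint (L : Type) 3 V.Hm)
        (pieceLift M (adelicUnitaryRat (L : Type) V.Hm) π (cmPrincipalPoint (L : Type) 3 V.Hm) f))
      (pieceMeasure M (adelicUnitaryRat (L : Type) V.Hm) π (cmPrincipalPoint (L : Type) 3 V.Hm)
        ((quotU V).pullbackν (adelicUnitaryRat (L : Type) V.Hm) e hΓe)) := by
    rw [pieceDescend_pieceLift]
    exact f.continuous.aestronglyMeasurable
  /- ### Step 3: unfolding, with `fL` on the left and `f` on the right -/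
  rw [hΛL, hΛ]
  change ⟪(quotU V).pieceEmb (adelicUnitaryRat (L : Type) V.Hm) e hΓe M π (cmPrincipalPoint (L : Type) 3 V.Hm) hMo hπc fL,
      (quotU V).realise ((quotU V).wedge₂ G₁ G₂)⟫_ℂ =
    ⟪(quotU V).pieceEmb (adelicUnitaryRat (L : Type) V.Hm) e hΓe M π (cmPrincipalPoint (L : Type) 3 V.Hm) hMo hπc fL,
      (quotU V).pieceEmb (adelicUnitaryRat (L : Type) V.Hm) e hΓe M π (cmPrincipalPoint (L : Type) 3 V.Hm) hMo hπc f⟫_ℂ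
  rw [(quotU V).inner_pieceEmb_left (adelicUnitaryRat (L : Type) V.Hm) e hΓe M π hπs
    (cmPrincipalPoint (L : Type) 3 V.Hm) hMo hπc fL _ hu_inv hvu hum,
    (quotU V).inner_pieceEmb (adelicUnitaryRat (L : Type) V.Hm) e hΓe M π
    (cmPrincipalPoint (L : Type) 3 V.Hm) hMo hπc fL f]
  simp_rw [pieceDescend_pieceLift]


/-- **`meet` at one level, conclusion shape**: a non-trivial pairing of `Λ_Γ(η₁, η₂)` with the global wedge-function `realise (G₁ ∧ G₂)`
of saturated representatives of `cl₁, cl₂` is a non-trivial pairing `⟪Λ_Γ(cl₁, cl₂), Λ_Γ(η₁, η₂)⟫ ≠ 0`. -/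
theorem inner_Λ_ne_zero_of_inner_realise_ne_zero
    (hι : ∀ u : U21, (S V c).ιinf u =
      Adelic.regimeEquiv L V.Hm hV (archSectionU21CM (L : Type) ι₁ V.Hm V.sylvesterFrame (sylvesterFrame_J V) u))
    (Γ : Level V) (η₁ η₂ : (picardCMUniverse hHD hI h₁ h₃).CohC ((picardCMUniverse hHD hI h₁ h₃).pms L ι₁ V Γ) 1)
    (cl₁ cl₂ : ((pinX hHD hI h₁ h₃ S V c hV).D Γ).H10) (G₁ G₂ : (quotU V).leftInvCont₂)
    (hS₁ : SatLevel V hV Γ G₁) (hS₂ : SatLevel V hV Γ G₂)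
    (hp₁ : ((((pinX hHD hI h₁ h₃ S V c hV).D Γ).pull cl₁).1 : (pinX hHD hI h₁ h₃ S V c hV).G₁ → (Fin 2 → ℂ)) =
      (G₁ : (quotU V).G → (Fin 2 → ℂ)) ∘ ((pinX hHD hI h₁ h₃ S V c hV).ιinf Γ))
    (hp₂ : ((((pinX hHD hI h₁ h₃ S V c hV).D Γ).pull cl₂).1 : (pinX hHD hI h₁ h₃ S V c hV).G₁ → (Fin 2 → ℂ)) =
      (G₂ : (quotU V).G → (Fin 2 → ℂ)) ∘ ((pinX hHD hI h₁ h₃ S V c hV).ιinf Γ))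
    (hne : ⟪(pinT hHD hI h₁ h₃ h hA W S μ).Λ Γ η₁ η₂, (quotU V).realise ((quotU V).wedge₂ G₁ G₂)⟫_ℂ ≠ 0) :
    ⟪(pinT hHD hI h₁ h₃ h hA W S μ).Λ Γ
        (cl₁ : (picardCMUniverse hHD hI h₁ h₃).CohC ((picardCMUniverse hHD hI h₁ h₃).pms L ι₁ V Γ) 1)
        (cl₂ : (picardCMUniverse hHD hI h₁ h₃).CohC ((picardCMUniverse hHD hI h₁ h₃).pms L ι₁ V Γ) 1),
      (pinT hHD hI h₁ h₃ h hA W S μ).Λ Γ η₁ η₂⟫_ℂ ≠ 0 := by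
  intro h0
  apply hne
  rw [inner_Λ_realise_wedge₂_of_pieceUnfolding hHD hI h₁ h₃ h hA W S μ V c hV hι Γ η₁ η₂ cl₁ cl₂ G₁ G₂ hS₁ hS₂ hp₁ hp₂,
    ← inner_conj_symm, h0, map_zero]

end Model

end HodgeCM

end
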